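import Mathlib
import HarnessLib
import Literature.Barriers.HubbardSuperconductivity.HohenbergMerminWagnerPairing
import Literature.Barriers.HubbardSuperconductivity.HohenbergMerminWagnerPairingSusceptibility
import Summits.HubbardSuperconductivity.HubbardSuperconductivity.Theorems.KLProgrammePairSusceptibilityDefs

/-!
# Route `WeakCouplingBCS` — KL bridge audit, positive-temperature annex: what the Hohenberg–Mermin–Wagner pairing
# barrier does NOT say at the Kohn–Luttinger scale (row B6 of the cell's BRIDGE-AUDIT)

Companion of `…Theorems.WeakCouplingBCSKLBridgeAudit` (§2 B0a/B0b: no thermal pair-field LRO at any `L`-independent `β`;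
§6 B0e: no thermal quasi-average order), cell `gate-hubbard-kl`, seat `hubbard-kl-h1-p2` gen 2, LADDER-Hubbard WORDING OF
RECORD (ii) «T > 0 instability vs every-ground-state LRO».  The barrier's two-point bound is
`|⟨P_x† P_y⟩_{β,L}| ≤ C_g (dist(x,y)+1)^{-f(β|t|)}` with `f = pairDecayExponent`, `f(b) = (2+128b)/(1+128b)²`
(`Literature.Barriers.HubbardSuperconductivity.HohenbergMerminWagnerPairing`, Koma–Tasaki 1992).  This file records, as
elementary facts about `f`, the limits of that bound: `f ≤ 1/(64 β|t|)` and `f < 2` (so it caps ORDER, not the pair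
susceptibility, whose majorant grows like `L^{2-f}`); at the KL scale `β = e^{c/U²}` the exponent is `≤ e^{-c/U²}/64` and the
majorant is `≥ e^{-1}` out to `log(r+1) ≤ 64 e^{c/U²}`; and for every `η > 0` the majorant dominates `(r+1)^{-η}` at all low
enough temperatures — an algebraic (Kosterlitz–Thouless-type) pair quasi-order at an `L`-independent `β` is NOT theorem-false
in the tree.  No definitions; folklore real analysis on the tree's exponent.

References: T. Koma, H. Tasaki, Phys. Rev. Lett. 68 (1992) 3248, Theorem and (13)–(14); J. Fröhlich, T. Spencer,
Comm. Math. Phys. 81 (1981) 527 (the KT phase exists rigorously in classical 2D models — context only, not used).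

§8 (seat gen 3, row B0f of the cell's BRIDGE-AUDIT): the «instability» object itself — the static `d`-wave pair-field
susceptibility `thermalPairSusceptibility g β U μ L = β · Re (Δ_g†, Δ_g)_Duh / L²` of `…Theorems.KLProgrammePairSusceptibilityDefs`
(Scalapino's `P_d`) — carries NO pair order at any `L`-independent `β` either: by the barrier companion
`Literature.Barriers.HubbardSuperconductivity.HohenbergMerminWagnerPairingSusceptibility` (Dyson–Lieb–Simon `b ≤ g` for the
non-Hermitian pair field + the Koma–Tasaki bound in both operator orders), `χ_L ≤ β C_g L⁻² Σ_{x,y} (dist+1)^{-f(β)}`, so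
`χ_L / L² → 0` and `χ_L ≤ β C_g ((2R+1)² + L² (R+1)^{-f})` for every `R` (the `L^{2-f}`-type ceiling of row B6 in closed form);
in the KL box (`klRegime_not_thermal_dWaveDuhamelOrder`, prefix of the leaf verbatim) this is the Duhamel twin of §2's
`klRegime_not_thermal_dWavePairFieldLRO`.  References for §8: F. J. Dyson, E. H. Lieb, B. Simon, J. Stat. Phys. 18 (1978) 335,
Thm. 3.1; D. J. Scalapino, Phys. Rep. 250 (1995) 329, §2 (2.4).
-/

noncomputable section

namespace Summit.HubbardSuperconductivity.WeakCouplingBCS.KLBridgeAudit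

/-! ### What the positive-temperature barrier does NOT say at the KL scale

§2/§6 record that no pair ORDER survives at any `L`-independent `β` (B0a/B0b/B0e).  For the LADDER wording (ii) («T > 0
instability vs every-ground-state LRO») it matters equally what the Koma–Tasaki/McBryan–Spencer bound does NOT exclude:
its decay exponent `f(β|t|) = pairDecayExponent (β|t|) = (2 + 128β|t|)/(1 + 128β|t|)²` is `≤ 1/(64 β|t|)`, so (i) at the
KL scale `β = e^{c/U²}` (`t = 1`) it is itself exponentially small, `f ≤ e^{-c/U²}/64`, and the majorant
`C_g (r+1)^{-f}` carries no decay information before `log (r+1) ≳ 64 e^{c/U²}`; (ii) for every prescribed exponent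
`η > 0` the majorant dominates `(r+1)^{-η}` at all low enough temperatures — a Kosterlitz–Thouless-type ALGEBRAIC pair
quasi-order (power-law floor, `L`-divergent pair susceptibility) at an `L`-independent `β` is NOT theorem-false in the tree.
That is the one honest positive-temperature meaning of «superconducting instability» beyond perturbation theory; it lies
at `β > β_KT(U) ≫ e^{c/U²}`, outside the KL pair's box, and no tree arrow connects it to the `T = 0` every-ground-state
matrix in either direction (row B6 of the cell's BRIDGE-AUDIT). -/

/-- **The Koma–Tasaki decay exponent is at most `1/(64 b)`** (`b = β|t| > 0`):
`(2 + 128b)/(1 + 128b)² ≤ 2/(1 + 128b) ≤ 1/(64b)`. [folklore] -/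
theorem pairDecayExponent_le_inv {b : ℝ} (hb : 0 < b) :
    Literature.Barriers.HubbardSuperconductivity.pairDecayExponent b ≤ 1 / (64 * b) := by
  unfold Literature.Barriers.HubbardSuperconductivity.pairDecayExponent
  rw [div_le_div_iff₀ (by positivity) (by positivity)]
  nlinarith

/-- **The exponent is `< 2` at every positive temperature** (so the majorant `Σ_y (dist(x,y)+1)^{-f}` of the pair
susceptibility grows like `L^{2-f}`: the barrier caps ORDER, not the susceptibility). [folklore] -/
theorem pairDecayExponent_lt_two {b : ℝ} (hb : 0 < b) :
    Literature.Barriers.HubbardSuperconductivity.pairDecayExponent b < 2 := by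
  unfold Literature.Barriers.HubbardSuperconductivity.pairDecayExponent
  rw [div_lt_iff₀ (by positivity)]
  nlinarith

/-- **At the KL scale the barrier's exponent is exponentially small**: at `β = e^{c/U²}`, `t = 1`,
`f(β|t|) ≤ e^{-c/U²}/64`. [folklore] -/
theorem pairDecayExponent_klScale_le (c U : ℝ) :
    Literature.Barriers.HubbardSuperconductivity.pairDecayExponent (Real.exp (c / U ^ 2) * |(1 : ℝ)|) ≤
      Real.exp (-(c / U ^ 2)) / 64 := by
  have hβ : 0 < Real.exp (c / U ^ 2) * |(1 : ℝ)| := by simp [Real.exp_pos]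
  refine (pairDecayExponent_le_inv hβ).trans (le_of_eq ?_)
  rw [abs_one, mul_one, Real.exp_neg]
  field_simp

/-- **No decay information at the KL scale before astronomically large distances**: at `β = e^{c/U²}`, `t = 1`, for every
distance `r ≥ 0` with `log (r+1) ≤ 64 e^{c/U²}` the Koma–Tasaki majorant `(r+1)^{-f}` is still `≥ e^{-1}`. [folklore] -/
theorem hmwMajorant_ge_exp_neg_one_at_klScale (c U : ℝ) {r : ℝ} (hr : 0 ≤ r)
    (hlog : Real.log (r + 1) ≤ 64 * Real.exp (c / U ^ 2)) :
    Real.exp (-1) ≤ (r + 1) ^ (-Literature.Barriers.HubbardSuperconductivity.pairDecayExponent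
      (Real.exp (c / U ^ 2) * |(1 : ℝ)|)) := by
  set f := Literature.Barriers.HubbardSuperconductivity.pairDecayExponent (Real.exp (c / U ^ 2) * |(1 : ℝ)|) with hf
  have hf0 : 0 < f := Literature.Barriers.HubbardSuperconductivity.pairDecayExponent_pos (by positivity)
  have hfle : f ≤ Real.exp (-(c / U ^ 2)) / 64 := pairDecayExponent_klScale_le c U
  have hr1 : 0 < r + 1 := by linarith
  rw [Real.rpow_def_of_pos hr1]
  refine Real.exp_le_exp.2 ?_
  -- `log(r+1) · f ≤ 64 e^{c/U²} · e^{-c/U²}/64 = 1`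
  have hlog0 : 0 ≤ Real.log (r + 1) := Real.log_nonneg (by linarith)
  have h1 : Real.log (r + 1) * f ≤ 64 * Real.exp (c / U ^ 2) * (Real.exp (-(c / U ^ 2)) / 64) :=
    mul_le_mul hlog hfle hf0.le (by positivity)
  have h2 : 64 * Real.exp (c / U ^ 2) * (Real.exp (-(c / U ^ 2)) / 64) = 1 := by
    rw [Real.exp_neg]; field_simp
  nlinarith

/-- **Algebraic quasi-order is not excluded at low temperature**: for every exponent `η > 0` and hopping `t ≠ 0` there is
`β₀` such that for all `β ≥ β₀` and all distances `r ≥ 0`, `(r+1)^{-η} ≤ (r+1)^{-f(β|t|)}` — a power-law FLOOR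
`c (r+1)^{-η}` on the thermal pair correlations (Kosterlitz–Thouless phase) is compatible with the tree's
Hohenberg–Mermin–Wagner bound `|G| ≤ C_g (r+1)^{-f(β|t|)}` whenever `c ≤ C_g`. [folklore] -/
theorem rpow_neg_le_hmwMajorant_of_lowTemperature {η t : ℝ} (hη : 0 < η) (ht : t ≠ 0) :
    ∃ β₀ : ℝ, 0 < β₀ ∧ ∀ β : ℝ, β₀ ≤ β → ∀ r : ℝ, 0 ≤ r →
      (r + 1) ^ (-η) ≤ (r + 1) ^ (-Literature.Barriers.HubbardSuperconductivity.pairDecayExponent (β * |t|)) := by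
  have ht' : 0 < |t| := abs_pos.2 ht
  refine ⟨1 / (64 * η * |t|), by positivity, fun β hβ r hr => ?_⟩
  have hβ0 : 0 < β := lt_of_lt_of_le (by positivity) hβ
  have hb : 0 < β * |t| := by positivity
  have hf : Literature.Barriers.HubbardSuperconductivity.pairDecayExponent (β * |t|) ≤ η := by
    refine (pairDecayExponent_le_inv hb).trans ?_
    rw [div_le_iff₀ (by positivity)]
    have : 1 / (64 * η * |t|) * (64 * η * |t|) = 1 := by field_simp
    have h64 : 0 < 64 * η * |t| := by positivity
    nlinarith [mul_le_mul_of_nonneg_right hβ h64.le]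
  exact Real.rpow_le_rpow_of_exponent_le (by linarith) (by linarith)

/-! ### §8 The susceptibility (Duhamel) carrier: no `L`-uniform Duhamel pair order at `T > 0` (BRIDGE-AUDIT row B0f)

The Kohn–Luttinger «instability» is phrased in the static pair-field susceptibility `χ_L(β) = β · Re (Δ_d†, Δ_d)_Duh / L²`
(`thermalPairSusceptibility`, Scalapino's `P_d`; RKS 2010 §II).  An `L`-UNIFORM FLOOR on `χ_L / L²` — Duhamel-normalised pair
ORDER, `χ_L ≍ β L²` — would be the third positive-temperature carrier of pairing order after two-point LRO (§2, B0a/b) and the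
quasi-average (§6, B0e).  It is theorem-false at every `L`-independent `β ≥ 0`, uniformly in `U`, `μ`: Dyson–Lieb–Simon's
`b ≤ g` for the NON-Hermitian pair field, `Re (Δ†, Δ)_Duh ≤ ½(Re⟨Δ†Δ⟩ + Re⟨ΔΔ†⟩)`, and the Koma–Tasaki bound in BOTH operator
orders (`‖⟨P_x† P_y⟩‖, ‖⟨P_x P_y†⟩‖ ≤ C_g (dist+1)^{-f(β|t|)}`, barrier companion `…HohenbergMerminWagnerPairingSusceptibility`)
give `χ_L ≤ β C_g L⁻² Σ_{x,y} (dist(x,y)+1)^{-f}`, hence `χ_L / L² → 0` and, for every cut-off radius `R`,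
`χ_L ≤ β C_g ((2R+1)² + L² (R+1)^{-f})` — the only growth the barrier allows is the `L^{2-f}`-type one of row B6
(Kosterlitz–Thouless quasi-order, not excluded, not reached by the KL pair, connected to `S` by no tree arrow). -/

section Susceptibility

open Filter Topology
open scoped Matrix
open Literature.MathematicalPhysics.QuantumLattice Literature.Probability.LatticeModels
open Literature.Barriers.HubbardSuperconductivity
open Summit.HubbardSuperconductivity.HubbardSuperconductivity.Theorems.KLProgrammePairSusceptibility
  (thermalPairSusceptibility)

/-- The pair-field susceptibility at a positive side, unfolded: `χ_L = β · Re (Δ_g†, Δ_g)_Duh / L²` in the Gibbs state of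
`hubbardTorusWith 2 L 1 U μ`. [cite: Scalapino1995, §2 (2.4)] -/
theorem thermalPairSusceptibility_of_neZero (g : Site 2 → ℝ) (β U μ : ℝ) (L : ℕ) [NeZero L] :
    thermalPairSusceptibility g β U μ L =
      β * (Matrix.duhamel β (hubbardTorusWith 2 L 1 U μ) (pairField g L)ᴴ (pairField g L)).re / (L : ℝ) ^ 2 := by
  unfold thermalPairSusceptibility
  rw [dif_neg (NeZero.ne L)]

/-- The pair-field susceptibility is non-negative for `β ≥ 0` (`Re (A, A†)_Duh ≥ 0`, Dyson–Lieb–Simon). [cite: DLS1978, Thm. 3.1] -/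
theorem thermalPairSusceptibility_nonneg (g : Site 2 → ℝ) {β : ℝ} (hβ : 0 ≤ β) (U μ : ℝ) (L : ℕ) :
    0 ≤ thermalPairSusceptibility g β U μ L := by
  rcases Nat.eq_zero_or_pos L with hL | hL
  · subst hL; simp
  · haveI : NeZero L := ⟨hL.ne'⟩
    rw [thermalPairSusceptibility_of_neZero]
    have hH : (hubbardTorusWith 2 L 1 U μ).IsHermitian := isHermitian_hamiltonianWith _ 1 U μ
    have h := re_duhamel_conjTranspose_nonneg hH (pairField g L)ᴴ β
    rw [Matrix.conjTranspose_conjTranspose] at h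
    positivity

/-- **B0f, quantitative: the pair susceptibility is dominated by the Koma–Tasaki majorant** — for every form factor `g`,
`β ≥ 0`, `U`, `μ` and side `L ≥ 1`, `χ_L ≤ β · C_g · (Σ_{x,y ∈ (ℤ/Lℤ)²} (dist(x,y)+1)^{-f(β)}) / L²`
(`C_g = pairFieldDecayConst g`, `f = pairDecayExponent`). [cite: DLS1978, Thm. 3.1] [cite: KomaTasakiPRL1992, Theorem eq. (2) and footnote [10]] -/
theorem thermalPairSusceptibility_le_decaySum (g : Site 2 → ℝ) {β : ℝ} (hβ : 0 ≤ β) (U μ : ℝ) (L : ℕ)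
    [NeZero L] :
    thermalPairSusceptibility g β U μ L ≤
      β * (pairFieldDecayConst g * ∑ x : TorusSite 2 L, ∑ y : TorusSite 2 L,
        ((torusDist x y : ℝ) + 1) ^ (-pairDecayExponent (β * |(1 : ℝ)|))) / (L : ℝ) ^ 2 := by
  rw [thermalPairSusceptibility_of_neZero]
  have hL : (0 : ℝ) < (L : ℝ) ^ 2 := by
    have : (0 : ℝ) < (L : ℝ) := by exact_mod_cast Nat.pos_of_ne_zero (NeZero.ne L)
    positivity
  exact div_le_div_of_nonneg_right
    (mul_le_mul_of_nonneg_left (re_duhamel_pairField_le g 1 U μ hβ (L := L)) hβ) hL.le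

/-- **B0f in closed form: the only growth allowed is `L^{2-f}`-type** — for every cut-off radius `R`,
`χ_L ≤ β · C_g · ((2R+1)² + L² (R+1)^{-f(β)})` (all `g`, `β ≥ 0`, `U`, `μ`, `L ≥ 1`).
[cite: DLS1978, Thm. 3.1] [cite: KomaTasakiPRL1992, Theorem eq. (2) and p. 3] -/
theorem thermalPairSusceptibility_le_of_radius (g : Site 2 → ℝ) {β : ℝ} (hβ : 0 ≤ β) (U μ : ℝ) (L : ℕ)
    [NeZero L] (R : ℕ) :
    thermalPairSusceptibility g β U μ L ≤
      β * pairFieldDecayConst g *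
        ((2 * R + 1 : ℝ) ^ 2 + (L : ℝ) ^ 2 * ((R : ℝ) + 1) ^ (-pairDecayExponent (β * |(1 : ℝ)|))) := by
  rw [thermalPairSusceptibility_of_neZero]
  have hLpos : (0 : ℝ) < (L : ℝ) := by exact_mod_cast Nat.pos_of_ne_zero (NeZero.ne L)
  have hL : (0 : ℝ) < (L : ℝ) ^ 2 := by positivity
  rw [div_le_iff₀ hL]
  have h := mul_le_mul_of_nonneg_left (re_duhamel_pairField_le_of_radius g 1 U μ hβ R (L := L)) hβ
  refine h.trans (le_of_eq ?_)
  ring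

/-- **No Duhamel pair-field order at any positive temperature** (the susceptibility twin of the Hohenberg–Mermin–Wagner pairing
barrier): for every form factor `g`, `β ≥ 0`, `U`, `μ`, `χ_L / L² → 0` as `L → ∞` — the static pair susceptibility is `o(L²)`.
[cite: KomaTasakiPRL1992, p. 3 ("rule out the condensation of various types of electron pairings")] [cite: DLS1978, Thm. 3.1] -/
theorem tendsto_thermalPairSusceptibility_div_sq_zero (g : Site 2 → ℝ) {β : ℝ} (hβ : 0 ≤ β) (U μ : ℝ) :
    Tendsto (fun L : ℕ => thermalPairSusceptibility g β U μ L / (L : ℝ) ^ 2) atTop (𝓝 0) := by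
  rw [Metric.tendsto_atTop]
  intro ε hε
  have hε' : 0 < ε / (β + 1) := div_pos hε (by linarith)
  obtain ⟨L₀, hL₀⟩ := re_duhamel_pairField_div_small g 1 hβ hε'
  refine ⟨max L₀ 1, fun L hL => ?_⟩
  have hL1 : 1 ≤ L := le_of_max_le_right hL
  haveI : NeZero L := ⟨by omega⟩
  have hLpos : (0 : ℝ) < (L : ℝ) := by exact_mod_cast hL1
  have hkey := hL₀ L (le_of_max_le_left hL) U μ
  have h0 := thermalPairSusceptibility_nonneg g hβ U μ L
  rw [Real.dist_0_eq_abs, abs_of_nonneg (div_nonneg h0 (by positivity)),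
    thermalPairSusceptibility_of_neZero]
  have hre : β * (Matrix.duhamel β (hubbardTorusWith 2 L 1 U μ) (pairField g L)ᴴ (pairField g L)).re /
      (L : ℝ) ^ 2 / (L : ℝ) ^ 2 =
      β * ((Matrix.duhamel β (hubbardTorusWith 2 L 1 U μ) (pairField g L)ᴴ (pairField g L)).re /
        (L : ℝ) ^ 4) := by
    field_simp
  rw [hre]
  calc β * ((Matrix.duhamel β (hubbardTorusWith 2 L 1 U μ) (pairField g L)ᴴ (pairField g L)).re / (L : ℝ) ^ 4)
      ≤ β * (ε / (β + 1)) := mul_le_mul_of_nonneg_left hkey hβ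
    _ < ε := by
        rw [mul_div_assoc', div_lt_iff₀ (by linarith : (0 : ℝ) < β + 1)]
        nlinarith

/-- **BRIDGE-AUDIT row B0f**: at every `L`-independent `β ≥ 0` and all `U`, `μ`, `g`, there is NO `L`-uniform floor on the
Duhamel-normalised pair order parameter `χ_L / L²` (eventually in `L`). [cite: KomaTasakiPRL1992, p. 3] [cite: DLS1978, Thm. 3.1] -/
theorem not_thermal_duhamelPairOrder (g : Site 2 → ℝ) {β : ℝ} (hβ : 0 ≤ β) (U μ : ℝ) :
    ¬ ∃ a : ℝ, 0 < a ∧ ∀ᶠ L : ℕ in atTop, a ≤ thermalPairSusceptibility g β U μ L / (L : ℝ) ^ 2 := by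
  rintro ⟨a, ha, hev⟩
  have hlt : ∀ᶠ L : ℕ in atTop, thermalPairSusceptibility g β U μ L / (L : ℝ) ^ 2 < a :=
    (tendsto_thermalPairSusceptibility_div_sq_zero g hβ U μ).eventually (gt_mem_nhds ha)
  obtain ⟨L, h1, h2⟩ := (hev.and hlt).exists
  exact absurd h1 (not_le.2 h2)

/-- **The KL box carries no Duhamel `d`-wave pair order** — with the quantifier prefix of the leaf `H1TwoPointLimitKLScaleD`
verbatim (`δ ∈ [0.10, 0.35]`, `0 < U ≤ U₀`, `0 < β ≤ e^{c/U²}`, ANY `U₀, c`) and at every chemical potential `μ`: no floor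
`a ≤ χ_L(β, U, μ) / L²` eventually in `L` for the `d_{x²-y²}` pair susceptibility — the Duhamel twin of §2's
`klRegime_not_thermal_dWavePairFieldLRO` (B0a) and §6's `not_thermal_dWaveSourceOrder` (B0e).
[cite: KomaTasakiPRL1992, p. 3] [cite: DLS1978, Thm. 3.1] -/
theorem klRegime_not_thermal_dWaveDuhamelOrder (U₀ c : ℝ) :
    ∀ δ ∈ Set.Icc (0.10 : ℝ) 0.35, ∀ U β : ℝ, 0 < U → U ≤ U₀ → 0 < β → β ≤ Real.exp (c / U ^ 2) →
      ∀ μ : ℝ, ¬ ∃ a : ℝ, 0 < a ∧ ∀ᶠ L : ℕ in atTop,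
        a ≤ thermalPairSusceptibility dWaveFormFactor β U μ L / (L : ℝ) ^ 2 :=
  fun _δ _hδ U _β _hU _hUle hβ _hβle μ => not_thermal_duhamelPairOrder dWaveFormFactor hβ.le U μ

end Susceptibility

end Summit.HubbardSuperconductivity.WeakCouplingBCS.KLBridgeAudit

end
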